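import Mathlib
import Literature.NumberTheory.LFunctions.Zhang2022.SkeletonPartThree
import HarnessLib

/-!
# Zhang (2022), §16 p. 95: the endgame `(16.12) + (16.16) + 𝓡₂*𝓡₂ⱼ ⇒ Φ₂(p) = −(𝔢₁+𝔢₂)𝔞p + o(p)`,
# and the step `𝓡₂*𝓡₂ⱼ = −1/L′(1,χ) + O(𝓛⁻¹L′(1,χ)⁻¹)` — kernel-checked

Topic `Literature/NumberTheory/LFunctions/Zhang2022` (Landau–Siegel audit tree; verdict-neutral).
Y. Zhang, *Discrete mean estimates and the Landau–Siegel zero*, arXiv:2211.02515v1 (2022)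
[Zhang2022LandauSiegel] — **an unrefereed manuscript under adjudication**; the displays referred to
are CLAIM nodes (`Typed.Section16A`, `Typed.Section16B`, `SkeletonPartThree`), stated not asserted.
This file proves, in the skeleton's vocabulary (the one-line specialisations to the typed nodes live in
`Section16Eval1617Typed`), two steps of §16 p. 95 that refine the coarse node `Skeleton.Ded1617` (the identity
`1∗χτ₂ = ν∗χ` of p. 94 is the companion file `Section16ConvIdentity`):

* `norm_rhoProd_add_inv_le` — "so that `𝓡₂*𝓡₂ⱼ = −1/L′(1,χ) + O(𝓛⁻¹L′(1,χ)⁻¹)`" (§16 p. 95,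
  tex L4678, DAG `Z22:§16.u044`) from the preceding display `𝓡₂* = β₁ + O(𝓛⁻¹⁰)`,
  `𝓡₂ⱼ = −1/(β₁L′(1,χ)) + O(𝓛⁶)` (`Z22:§16.u043`): the exact identity
  `𝓡₂*𝓡₂ⱼ + 1/L′ = (𝓡₂* − β₁)𝓡₂ⱼ + β₁(𝓡₂ⱼ + 1/(β₁L′))` and `α/2 ≤ |β₁| ≤ 2α`, `α = π/𝓛⁹`, with the
  classical `|L′(1,χ)| ≤ 4e^{9/2}𝓛²` (tree: `Lemma31.norm_deriv_LFunction_le_near_one`) to express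
  `𝓛⁻⁴`, `𝓛⁻³` as `O(𝓛⁻¹|L′|⁻¹)`; constant `2C/π + 4e^{9/2}C² + 8πe^{9/2}C`.
* `phi2p_eval_of_parts` — "This together with (16.16) and (16.12) yields
  `Φ₂(p) = −(𝔢₁+𝔢₂)𝔞p + o(p)`" (§16 p. 95, tex L4682, DAG `Z22:§16.u045`), as a kernel edge for ANY
  `Φ₂(p), 𝓡₂*, 𝓡₂ⱼ, 𝒮₂ⱼ`, from (16.12), (16.16), the `𝓡₂*𝓡₂ⱼ` display, Lemma 5.7 of the tree
  (`Lemma57.lemma_5_7`: `L′(1,χ) ≥ (4e)⁻¹D/φ(D)` under (A)) — AND ONE EXTRA HYPOTHESIS that the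
  manuscript does not supply: **`𝔞 = o(𝓛)`** (`hsmall`). AS PRINTED the step does not follow: the
  relative error `O(𝓛⁻¹)` of `𝓡₂*𝓡₂ⱼ` times the main term `𝔞𝔢ⱼ(φ(D)/D)L′(1,χ)` of (16.16) leaves
  `O(𝓛⁻¹𝔞p)`, which is `o(p)` iff `𝔞 = (6/π²)L′(1,χ)²∏ q/(q+1) = o(𝓛)`; the manuscript records only
  `𝔞 ≫ 1` (§2 after (2.31), Lemma 5.7) and the classical bound is `L′(1,χ) ≪ 𝓛²`. Recorded as a
  GAP-LEDGER row of the adjudication (repairable: sharper residue asymptotics, or errors `o(𝔞p)`).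

Nothing upstream is asserted; nothing about Theorems 1–2 of the source; nothing here bears on the
cell's verdict on (8.24).

## References

* Y. Zhang, arXiv:2211.02515v1 (2022), §16 (16.12), (16.16), p. 95; §5 Lemma 5.7;
  §2 (2.13), (2.31). [cite: Zhang2022LandauSiegel, §16 p.95]
-/

noncomputable section

open Complex Real

namespace Literature.NumberTheory.LFunctions.Zhang2022.Skeleton

/-! ## `𝓡₂*𝓡₂ⱼ = −1/L′ + O(𝓛⁻¹L′⁻¹)` from `𝓡₂* = β₁ + O(𝓛⁻¹⁰)`, `𝓡₂ⱼ = −1/(β₁L′) + O(𝓛⁶)` -/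

section Residues

variable (c' : ℝ) {D : ℕ}

/-- `|β₁| = α|1 − 5c′α𝓛|`. [cite: Zhang2022LandauSiegel, §2 (2.13)] -/
theorem norm_beta1 (hα : 0 ≤ alpha D) :
    ‖beta1 c' D‖ = alpha D * |1 - 5 * c' * alpha D * ell D| := by
  rw [beta1, norm_mul, norm_mul, Complex.norm_I, one_mul, Complex.norm_real, Complex.norm_real,
    Real.norm_of_nonneg hα, Real.norm_eq_abs]

/-- For `5|c′|α𝓛 ≤ 1/2`: `α/2 ≤ |β₁| ≤ 2α`. [cite: Zhang2022LandauSiegel, §2 (2.13)] -/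
theorem norm_beta1_bounds (hα : 0 ≤ alpha D) (hαℓ : 0 ≤ alpha D * ell D)
    (h : 5 * |c'| * (alpha D * ell D) ≤ 1 / 2) :
    alpha D / 2 ≤ ‖beta1 c' D‖ ∧ ‖beta1 c' D‖ ≤ 2 * alpha D := by
  rw [norm_beta1 c' hα]
  have h1 : |5 * c' * alpha D * ell D| ≤ 1 / 2 := by
    rw [show 5 * c' * alpha D * ell D = c' * (5 * (alpha D * ell D)) by ring, abs_mul,
      abs_of_nonneg (by positivity : (0 : ℝ) ≤ 5 * (alpha D * ell D))]
    linarith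
  have hlo : 1 / 2 ≤ |1 - 5 * c' * alpha D * ell D| := by
    have := abs_sub_abs_le_abs_sub (1 : ℝ) (5 * c' * alpha D * ell D)
    rw [abs_one] at this; linarith
  have hhi : |1 - 5 * c' * alpha D * ell D| ≤ 2 := by
    have := abs_sub (1 : ℝ) (5 * c' * alpha D * ell D)
    rw [abs_one] at this; linarith
  constructor <;> nlinarith

/-- **The algebra of "so that `𝓡₂*𝓡₂ⱼ = −1/L′(1,χ) + O(𝓛⁻¹L′(1,χ)⁻¹)`"** (§16 p. 95, tex L4678,
DAG `Z22:§16.u044` ⇐ `Z22:§16.u043`), with every size made explicit: for `ℓ ≥ 1`, `αℓ⁹ = π`,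
`α/2 ≤ |β| ≤ 2α`, `L ≠ 0` with `|L| ≤ 4e^{9/2}ℓ²` (the classical `L′(1,χ) ≪ 𝓛²`), and
`|𝓡* − β| ≤ Cℓ⁻¹⁰`, `|𝓡 + 1/(βL)| ≤ Cℓ⁶` (`C ≥ 0`):
`|𝓡*𝓡 + 1/L| ≤ (2C/π + 4e^{9/2}C² + 8πe^{9/2}C)·ℓ⁻¹|L|⁻¹`, via
`𝓡*𝓡 + 1/L = (𝓡* − β)𝓡 + β(𝓡 + 1/(βL))`. [cite: Zhang2022LandauSiegel, §16 p.95] -/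
theorem norm_rhoProd_add_inv_le {C ℓ α : ℝ} {Rs R β L : ℂ} (hℓ : 1 ≤ ℓ) (hC : 0 ≤ C)
    (hα : α * ℓ ^ 9 = π) (hβl : α / 2 ≤ ‖β‖) (hβu : ‖β‖ ≤ 2 * α) (hL0 : L ≠ 0)
    (hLu : ‖L‖ ≤ 4 * Real.exp (9 / 2) * ℓ ^ 2)
    (h1 : ‖Rs - β‖ ≤ C * (ℓ ^ 10)⁻¹) (h2 : ‖R + 1 / (β * L)‖ ≤ C * ℓ ^ 6) :
    ‖Rs * R + 1 / L‖ ≤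
      (2 * C / π + 4 * Real.exp (9 / 2) * C ^ 2 + 8 * π * Real.exp (9 / 2) * C) / (ℓ * ‖L‖) := by
  have hℓ0 : 0 < ℓ := by linarith
  have hαeq : α = π / ℓ ^ 9 := by rw [← hα]; field_simp
  have hα0 : 0 < α := by rw [hαeq]; positivity
  have hβ0 : β ≠ 0 := by
    intro h; rw [h, norm_zero] at hβl; linarith
  set nL : ℝ := ‖L‖ with hnL
  have hnL0 : 0 < nL := norm_pos_iff.mpr hL0
  have hE : 0 < Real.exp (9 / 2) := Real.exp_pos _
  -- the exact identity
  have hid : Rs * R + 1 / L = (Rs - β) * R + β * (R + 1 / (β * L)) := by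
    field_simp
    ring
  -- `‖R‖ ≤ 2/(α nL) + C ℓ⁶`
  have hR : ‖R‖ ≤ 2 / (α * nL) + C * ℓ ^ 6 := by
    have h3 : ‖R‖ ≤ ‖R + 1 / (β * L)‖ + ‖(1 / (β * L) : ℂ)‖ := by
      calc ‖R‖ = ‖(R + 1 / (β * L)) - 1 / (β * L)‖ := by ring_nf
        _ ≤ _ := norm_sub_le _ _
    have h4 : ‖(1 / (β * L) : ℂ)‖ ≤ 2 / (α * nL) := by
      rw [norm_div, norm_one, norm_mul, ← hnL,
        div_le_div_iff₀ (mul_pos (norm_pos_iff.mpr hβ0) hnL0) (mul_pos hα0 hnL0)]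
      nlinarith
    linarith
  -- sizes: `1/ℓ⁴ ≤ 4e^{9/2}/(ℓ nL)` and `1/ℓ³ ≤ 4e^{9/2}/(ℓ nL)` (from `nL ≤ 4e^{9/2}ℓ²`, `ℓ ≥ 1`)
  have hℓ3 : ℓ ^ 3 ≤ ℓ ^ 4 := pow_le_pow_right₀ hℓ (by norm_num)
  have k4 : 1 / ℓ ^ 4 ≤ 4 * Real.exp (9 / 2) / (ℓ * nL) := by
    rw [div_le_div_iff₀ (pow_pos hℓ0 4) (mul_pos hℓ0 hnL0)]
    nlinarith [mul_le_mul_of_nonneg_left hLu hℓ0.le]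
  have k3 : 1 / ℓ ^ 3 ≤ 4 * Real.exp (9 / 2) / (ℓ * nL) := by
    rw [div_le_div_iff₀ (pow_pos hℓ0 3) (mul_pos hℓ0 hnL0)]
    nlinarith [mul_le_mul_of_nonneg_left hLu hℓ0.le]
  rw [hid]
  calc ‖(Rs - β) * R + β * (R + 1 / (β * L))‖
      ≤ ‖Rs - β‖ * ‖R‖ + ‖β‖ * ‖R + 1 / (β * L)‖ := by
        refine (norm_add_le _ _).trans ?_; rw [norm_mul, norm_mul]
    _ ≤ C * (ℓ ^ 10)⁻¹ * (2 / (α * nL) + C * ℓ ^ 6) + 2 * α * (C * ℓ ^ 6) := by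
        gcongr
    _ = 2 * C / π / (ℓ * nL) + C ^ 2 * (1 / ℓ ^ 4) + 2 * π * C * (1 / ℓ ^ 3) := by
        rw [hαeq]; field_simp
    _ ≤ 2 * C / π / (ℓ * nL) + C ^ 2 * (4 * Real.exp (9 / 2) / (ℓ * nL)) +
          2 * π * C * (4 * Real.exp (9 / 2) / (ℓ * nL)) := by
        gcongr
    _ = (2 * C / π + 4 * Real.exp (9 / 2) * C ^ 2 + 8 * π * Real.exp (9 / 2) * C) / (ℓ * ‖L‖) := by
        rw [hnL]; field_simp; ring

end Residues

/-! ## `Φ₂(p) = −(𝔢₁+𝔢₂)𝔞p + o(p)` from (16.12), (16.16), `𝓡₂*𝓡₂ⱼ`, Lemma 5.7 — and `𝔞 = o(𝓛)` -/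

section Endgame

/-- One term of the endgame: for `u = 𝓡*𝓡ⱼ + 1/L`, `v = 𝒮ⱼ − 𝔞𝔢ⱼ(φ/D)L` with `|u| ≤ C₂ℓ⁻¹|L|⁻¹`,
`|v| ≤ C₁ℓ⁻⁴`, and the sizes `D/φ ≤ 4e|L|` (Lemma 5.7), `𝔞 ≤ ηℓ` (the extra input), `ℓ ≥ 1`:
`(D/φ)·|u𝒮ⱼ − v/L| ≤ 4e(C₁C₂ + C₁)ℓ⁻¹ + C₂|𝔢ⱼ|η`. [cite: Zhang2022LandauSiegel, §16 p.95] -/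
theorem endgame_term {u S v L e : ℂ} {a φ Dr C₁ C₂ η ℓ : ℝ} (hL : L ≠ 0) (hφ : 0 < φ) (hD : 0 < Dr)
    (ha : 0 ≤ a) (hC₁ : 0 ≤ C₁) (hC₂ : 0 ≤ C₂) (hℓ : 1 ≤ ℓ)
    (hρL : Dr / φ ≤ 4 * Real.exp 1 * ‖L‖) (haℓ : a ≤ η * ℓ)
    (hv : v = S - a * e * (φ / Dr) * L) (h16 : ‖v‖ ≤ C₁ * (ℓ ^ 4)⁻¹)
    (h44 : ‖u‖ ≤ C₂ * ℓ⁻¹ * ‖L‖⁻¹) :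
    Dr / φ * ‖u * S - v / L‖ ≤ 4 * Real.exp 1 * (C₁ * C₂ + C₁) * ℓ⁻¹ + C₂ * ‖e‖ * η := by
  have hℓ0 : 0 < ℓ := by linarith
  set nL : ℝ := ‖L‖ with hnL
  have hnL0 : 0 < nL := norm_pos_iff.mpr hL
  have hρ0 : 0 ≤ Dr / φ := by positivity
  -- `‖S‖ ≤ ‖v‖ + a‖e‖(φ/D)‖L‖`
  have hS : ‖S‖ ≤ C₁ * (ℓ ^ 4)⁻¹ + a * ‖e‖ * (φ / Dr) * nL := by
    have : S = v + a * e * (φ / Dr) * L := by rw [hv]; ring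
    rw [this]
    refine (norm_add_le _ _).trans ?_
    have hn : ‖(a * e * (φ / Dr) * L : ℂ)‖ = a * ‖e‖ * (φ / Dr) * nL := by
      rw [norm_mul, norm_mul, norm_mul, Complex.norm_real, Real.norm_of_nonneg ha, ← ofReal_div,
        Complex.norm_real, Real.norm_of_nonneg (by positivity)]
    rw [hn]; gcongr
  -- `‖uS − v/L‖ ≤ ‖u‖‖S‖ + ‖v‖/‖L‖`
  have h1 : ‖u * S - v / L‖ ≤ C₂ * ℓ⁻¹ * nL⁻¹ * (C₁ * (ℓ ^ 4)⁻¹ + a * ‖e‖ * (φ / Dr) * nL) +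
      C₁ * (ℓ ^ 4)⁻¹ * nL⁻¹ := by
    calc ‖u * S - v / L‖ ≤ ‖u‖ * ‖S‖ + ‖v‖ * nL⁻¹ := by
          refine (norm_sub_le _ _).trans ?_
          rw [norm_mul, norm_div, hnL, div_eq_mul_inv]
      _ ≤ _ := by gcongr
  -- multiply by `ρ = D/φ` and simplify: `ρ(φ/D) = 1`, `ρ nL⁻¹ ≤ 4e`, `a ℓ⁻¹ ≤ η`
  have hρnL : Dr / φ * nL⁻¹ ≤ 4 * Real.exp 1 := by
    rw [← div_eq_mul_inv, div_le_iff₀ hnL0]; exact hρL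
  have hρφ : Dr / φ * (φ / Dr) = 1 := by field_simp
  have haℓ' : a * ℓ⁻¹ ≤ η := by
    rw [← div_eq_mul_inv, div_le_iff₀ hℓ0]; exact haℓ
  have hℓ4 : (ℓ ^ 4)⁻¹ ≤ ℓ⁻¹ := by
    rw [inv_le_inv₀ (pow_pos hℓ0 4) hℓ0]; exact le_self_pow₀ hℓ (by norm_num)
  have hℓ5 : ℓ⁻¹ * (ℓ ^ 4)⁻¹ ≤ ℓ⁻¹ := by
    have : (ℓ ^ 4)⁻¹ ≤ 1 := inv_le_one_of_one_le₀ (one_le_pow₀ hℓ)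
    have h0 : 0 ≤ ℓ⁻¹ := by positivity
    nlinarith
  calc Dr / φ * ‖u * S - v / L‖
      ≤ Dr / φ * (C₂ * ℓ⁻¹ * nL⁻¹ * (C₁ * (ℓ ^ 4)⁻¹ + a * ‖e‖ * (φ / Dr) * nL) +
          C₁ * (ℓ ^ 4)⁻¹ * nL⁻¹) := mul_le_mul_of_nonneg_left h1 hρ0
    _ = C₁ * C₂ * (ℓ⁻¹ * (ℓ ^ 4)⁻¹) * (Dr / φ * nL⁻¹) +
          C₂ * ‖e‖ * (a * ℓ⁻¹) * (Dr / φ * (φ / Dr)) * (nL * nL⁻¹) +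
          C₁ * (ℓ ^ 4)⁻¹ * (Dr / φ * nL⁻¹) := by ring
    _ = C₁ * C₂ * (ℓ⁻¹ * (ℓ ^ 4)⁻¹) * (Dr / φ * nL⁻¹) + C₂ * ‖e‖ * (a * ℓ⁻¹) +
          C₁ * (ℓ ^ 4)⁻¹ * (Dr / φ * nL⁻¹) := by
        rw [hρφ, mul_inv_cancel₀ hnL0.ne']; ring
    _ ≤ C₁ * C₂ * ℓ⁻¹ * (4 * Real.exp 1) + C₂ * ‖e‖ * η + C₁ * ℓ⁻¹ * (4 * Real.exp 1) := by
        gcongr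
    _ = 4 * Real.exp 1 * (C₁ * C₂ + C₁) * ℓ⁻¹ + C₂ * ‖e‖ * η := by ring

/-- The endgame of §16 as pure algebra-with-sizes (all quantities explicit): from
(16.12) `|Φ − 𝓡*(Dp/φ)(𝓡₁𝒮₁ + 𝓡₂𝒮₂)| ≤ ε₁p`, (16.16) `|𝒮ⱼ − 𝔞𝔢ⱼ(φ/D)L| ≤ C₁ℓ⁻⁴`,
`|𝓡*𝓡ⱼ + 1/L| ≤ C₂ℓ⁻¹|L|⁻¹` (`j = 1,2`), `D/φ ≤ 4e|L|` (Lemma 5.7) and `𝔞 ≤ ηℓ`: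
`|Φ + (𝔢₁+𝔢₂)𝔞p| ≤ (ε₁ + 8e(C₁C₂+C₁)ℓ⁻¹ + C₂(|𝔢₁|+|𝔢₂|)η)·p`, via the exact identity
`Φ + (𝔢₁+𝔢₂)𝔞p = (Φ − 𝓡*(Dp/φ)Σ𝓡ⱼ𝒮ⱼ) + (Dp/φ)Σⱼ(uⱼ𝒮ⱼ − vⱼ/L)`, `uⱼ = 𝓡*𝓡ⱼ + 1/L`,
`vⱼ = 𝒮ⱼ − 𝔞𝔢ⱼ(φ/D)L`. [cite: Zhang2022LandauSiegel, §16 p.95] -/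
theorem endgame_core {Φ Rs R₁ R₂ S₁ S₂ L e₁ e₂ : ℂ} {Dn φn p : ℕ} {a ε₁ C₁ C₂ η ℓ : ℝ}
    (hL : L ≠ 0) (hφ : 0 < φn) (hD : 0 < Dn) (ha : 0 ≤ a) (hC₁ : 0 ≤ C₁) (hC₂ : 0 ≤ C₂)
    (hℓ : 1 ≤ ℓ)
    (hρL : (Dn : ℝ) / φn ≤ 4 * Real.exp 1 * ‖L‖) (haℓ : a ≤ η * ℓ)
    (h12 : ‖Φ - Rs * ((Dn : ℝ) * p : ℝ) / (φn : ℂ) * (R₁ * S₁ + R₂ * S₂)‖ ≤ ε₁ * p)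
    (h16₁ : ‖S₁ - (a : ℂ) * e₁ * ((φn : ℂ) / (Dn : ℂ)) * L‖ ≤ C₁ * (ℓ ^ 4)⁻¹)
    (h16₂ : ‖S₂ - (a : ℂ) * e₂ * ((φn : ℂ) / (Dn : ℂ)) * L‖ ≤ C₁ * (ℓ ^ 4)⁻¹)
    (h44₁ : ‖Rs * R₁ + 1 / L‖ ≤ C₂ * ℓ⁻¹ * ‖L‖⁻¹)
    (h44₂ : ‖Rs * R₂ + 1 / L‖ ≤ C₂ * ℓ⁻¹ * ‖L‖⁻¹) :
    ‖Φ + (e₁ + e₂) * a * p‖ ≤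
      (ε₁ + 8 * Real.exp 1 * (C₁ * C₂ + C₁) * ℓ⁻¹ + C₂ * (‖e₁‖ + ‖e₂‖) * η) * p := by
  have hφ0 : (φn : ℂ) ≠ 0 := Nat.cast_ne_zero.mpr hφ.ne'
  have hD0 : (Dn : ℂ) ≠ 0 := Nat.cast_ne_zero.mpr hD.ne'
  set u₁ : ℂ := Rs * R₁ + 1 / L
  set u₂ : ℂ := Rs * R₂ + 1 / L
  set v₁ : ℂ := S₁ - (a : ℂ) * e₁ * ((φn : ℂ) / (Dn : ℂ)) * L with hv₁
  set v₂ : ℂ := S₂ - (a : ℂ) * e₂ * ((φn : ℂ) / (Dn : ℂ)) * L with hv₂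
  -- the exact identity
  have hX : (((Dn : ℝ) * p : ℝ) : ℂ) = (Dn : ℂ) * (p : ℂ) := by push_cast; ring
  have hid : Φ + (e₁ + e₂) * a * p =
      (Φ - Rs * ((Dn : ℝ) * p : ℝ) / (φn : ℂ) * (R₁ * S₁ + R₂ * S₂)) +
      ((Dn : ℂ) * p / φn) * ((u₁ * S₁ - v₁ / L) + (u₂ * S₂ - v₂ / L)) := by
    rw [hX]
    simp only [u₁, u₂, hv₁, hv₂]
    field_simp
    ring
  rw [hid]
  have hρ : ‖((Dn : ℂ) * p / φn : ℂ)‖ = (Dn : ℝ) / φn * p := by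
    rw [norm_div, norm_mul, Complex.norm_natCast, Complex.norm_natCast, Complex.norm_natCast]; ring
  -- casts `((φ:ℕ):ℂ) = (((φ:ℕ):ℝ):ℂ)` for `endgame_term`
  have t₁ := endgame_term (e := e₁) (S := S₁) hL (Nat.cast_pos.mpr hφ) (Nat.cast_pos.mpr hD) ha hC₁
    hC₂ hℓ hρL haℓ (by simp only [hv₁, Complex.ofReal_natCast]) h16₁ h44₁
  have t₂ := endgame_term (e := e₂) (S := S₂) hL (Nat.cast_pos.mpr hφ) (Nat.cast_pos.mpr hD) ha hC₁
    hC₂ hℓ hρL haℓ (by simp only [hv₂, Complex.ofReal_natCast]) h16₂ h44₂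
  have hp0 : (0 : ℝ) ≤ p := Nat.cast_nonneg p
  calc ‖(Φ - Rs * ((Dn : ℝ) * p : ℝ) / (φn : ℂ) * (R₁ * S₁ + R₂ * S₂)) +
        ((Dn : ℂ) * p / φn) * ((u₁ * S₁ - v₁ / L) + (u₂ * S₂ - v₂ / L))‖
      ≤ ‖Φ - Rs * ((Dn : ℝ) * p : ℝ) / (φn : ℂ) * (R₁ * S₁ + R₂ * S₂)‖ +
        ‖((Dn : ℂ) * p / φn : ℂ)‖ * (‖u₁ * S₁ - v₁ / L‖ + ‖u₂ * S₂ - v₂ / L‖) := by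
          refine (norm_add_le _ _).trans ?_
          rw [norm_mul]
          gcongr
          exact norm_add_le _ _
    _ = ‖Φ - Rs * ((Dn : ℝ) * p : ℝ) / (φn : ℂ) * (R₁ * S₁ + R₂ * S₂)‖ +
        p * ((Dn : ℝ) / φn * ‖u₁ * S₁ - v₁ / L‖ + (Dn : ℝ) / φn * ‖u₂ * S₂ - v₂ / L‖) := by
          rw [hρ]; ring
    _ ≤ ε₁ * p + p * ((4 * Real.exp 1 * (C₁ * C₂ + C₁) * ℓ⁻¹ + C₂ * ‖e₁‖ * η) +
        (4 * Real.exp 1 * (C₁ * C₂ + C₁) * ℓ⁻¹ + C₂ * ‖e₂‖ * η)) := by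
          gcongr
    _ = (ε₁ + 8 * Real.exp 1 * (C₁ * C₂ + C₁) * ℓ⁻¹ + C₂ * (‖e₁‖ + ‖e₂‖) * η) * p := by ring


/-- Any real threshold on `𝓛 = log D` is met for all large `D`. [folklore] -/
private theorem exists_forall_le_ell' (M : ℝ) : ∃ D₀ : ℕ, ∀ D : ℕ, D₀ ≤ D → M ≤ ell D := by
  refine ⟨⌈Real.exp M⌉₊ + 1, fun D hD => ?_⟩
  have hD1 : (⌈Real.exp M⌉₊ : ℝ) + 1 ≤ D := by exact_mod_cast hD
  have hD0 : (0 : ℝ) < D := by linarith [Nat.le_ceil (Real.exp M), Real.exp_pos M]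
  rw [ell, Real.le_log_iff_exp_le hD0]
  linarith [Nat.le_ceil (Real.exp M)]

/-- **Lemma 5.7 of the tree, in the form used here**: under (A), for all large `D`,
`D/φ(D) ≤ 4e·|L′(1,χ)|` (`Lemma57.lemma_5_7`: `Re L′(1,χ) ≥ (4e)⁻¹D/φ(D)`); in particular
`L′(1,χ) ≠ 0`. [cite: Zhang2022LandauSiegel, §5 Lemma 5.7] -/
theorem self_div_totient_le_norm_deriv_L_one : ∃ D₀ : ℕ, ∀ (D : ℕ) [NeZero D]
    (χ : DirichletCharacter ℂ D), D₀ ≤ D → χ.IsQuadratic → χ.IsPrimitive → AssumptionA D χ →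
      (D : ℝ) / Nat.totient D ≤ 4 * Real.exp 1 * ‖deriv χ.LFunction 1‖ := by
  obtain ⟨L₀, hL₀⟩ := Lemma57.lemma_5_7
  obtain ⟨D₀, hD₀⟩ := exists_forall_le_ell' L₀
  refine ⟨D₀, fun D _ χ hD hq hp hA => ?_⟩
  have h := (hL₀ D χ hp hq.sq_eq_one (hD₀ D hD) (le_of_lt hA)).trans (Complex.re_le_norm _)
  have he : Real.exp 1 * Real.exp (-1) = 1 := by rw [← Real.exp_add]; simp
  calc (D : ℝ) / Nat.totient D = 4 * Real.exp 1 * (Real.exp (-1) / 4 * ((D : ℝ) / Nat.totient D)) := by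
        rw [show 4 * Real.exp 1 * (Real.exp (-1) / 4 * ((D : ℝ) / Nat.totient D)) =
          (Real.exp 1 * Real.exp (-1)) * ((D : ℝ) / Nat.totient D) by ring, he, one_mul]
    _ ≤ 4 * Real.exp 1 * ‖deriv χ.LFunction 1‖ := by gcongr

/-- **§16 p. 95, "This together with (16.16) and (16.12) yields `Φ₂(p) = −(𝔢₁+𝔢₂)𝔞p + o(p)`"**
(tex L4682, DAG `Z22:§16.u045` ⇐ `Z22:(16.12)` + `Z22:(16.16)` + `Z22:§16.u044`), as a kernel edge
for ANY `Φ₂(p)`, `𝓡₂*`, `𝓡₂ⱼ`, `𝒮₂ⱼ` (in the manuscript: (16.3), p. 90, (16.11), (16.12)), from the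
three displays as typed, Lemma 5.7 of the tree (`L′(1,χ) ≥ (4e)⁻¹D/φ(D)`), and ONE EXTRA
HYPOTHESIS `hsmall : 𝔞 = o(𝓛)` which the manuscript does not supply (it records only `𝔞 ≫ 1`).
WITHOUT `hsmall` the step does not follow from the displays as printed: the error
`O(𝓛⁻¹L′⁻¹)` of `𝓡₂*𝓡₂ⱼ` against the main term `𝔞𝔢ⱼ(φ(D)/D)L′` of (16.16) leaves `O(𝓛⁻¹𝔞)·p`.
The cell's GAP-LEDGER carries this as a repairable in-cone row. Constants: with `C₁, C₂` the
constants of (16.16) and of the `𝓡₂*𝓡₂ⱼ` display, the bound is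
`(ε₁ + 8e(C₁C₂+C₁)𝓛⁻¹ + C₂(|𝔢₁|+|𝔢₂|)η)p` (`endgame_core`). [cite: Zhang2022LandauSiegel, §16 p.95] -/
theorem phi2p_eval_of_parts
    (Φ : (D : ℕ) → [NeZero D] → DirichletCharacter ℂ D → ℕ → ℂ)
    (Rs : (D : ℕ) → [NeZero D] → DirichletCharacter ℂ D → ℂ)
    (R S : (D : ℕ) → [NeZero D] → DirichletCharacter ℂ D → ℕ → ℂ)
    (h1612 : ∀ ε : ℝ, 0 < ε → ForAllLarge fun D _ χ => AssumptionA D χ → ∀ p ∈ primeWindow D,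
      ‖Φ D χ p - Rs D χ * ((D : ℝ) * p : ℝ) / (Nat.totient D : ℂ) *
        ∑ j ∈ ({1, 2} : Finset ℕ), R D χ j * S D χ j‖ ≤ ε * p)
    (h1616 : ∃ C : ℝ, ForAllLarge fun D _ χ => AssumptionA D χ → ∀ j ∈ ({1, 2} : Finset ℕ),
      ‖S D χ j - (frakA χ : ℂ) * frake j * ((Nat.totient D : ℂ) / (D : ℂ)) * deriv χ.LFunction 1‖ ≤
        C * (ell D ^ 4)⁻¹)
    (h44 : ∃ C : ℝ, ForAllLarge fun D _ χ => AssumptionA D χ → ∀ j ∈ ({1, 2} : Finset ℕ),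
      ‖Rs D χ * R D χ j + 1 / deriv χ.LFunction 1‖ ≤ C * (ell D)⁻¹ * ‖deriv χ.LFunction 1‖⁻¹)
    (hsmall : ∀ η : ℝ, 0 < η → ForAllLarge fun D _ χ => AssumptionA D χ → frakA χ ≤ η * ell D) :
    ∀ ε : ℝ, 0 < ε → ForAllLarge fun D _ χ => AssumptionA D χ → ∀ p ∈ primeWindow D,
      ‖Φ D χ p + (frake 1 + frake 2) * frakA χ * p‖ ≤ ε * p := by
  intro ε hε
  obtain ⟨C₁, hC₁⟩ := h1616
  obtain ⟨C₂, hC₂⟩ := h44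
  set C₁' : ℝ := max C₁ 0 with hC₁'
  set C₂' : ℝ := max C₂ 0 with hC₂'
  have hC₁'0 : 0 ≤ C₁' := le_max_right _ _
  have hC₂'0 : 0 ≤ C₂' := le_max_right _ _
  set E : ℝ := ‖frake 1‖ + ‖frake 2‖ with hE
  have hE0 : 0 ≤ E := by positivity
  have hε4 : 0 < ε / 4 := by positivity
  set η : ℝ := ε / 4 / (C₂' * E + 1) with hη
  have hη0 : 0 < η := by positivity
  have hη4 : C₂' * E * η ≤ ε / 4 := by
    rw [hη, mul_div_assoc', div_le_iff₀ (by positivity)]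
    nlinarith [mul_nonneg hC₂'0 hE0]
  set K : ℝ := C₁' * C₂' + C₁' with hK
  have hK0 : 0 ≤ K := by positivity
  obtain ⟨Dl, hDl⟩ := self_div_totient_le_norm_deriv_L_one
  obtain ⟨D₁, h₁⟩ := (((h1612 _ hε4).and hC₁).and hC₂).and (hsmall η hη0)
  obtain ⟨D₂, h₂⟩ := exists_forall_le_ell' (max 1 (32 * Real.exp 1 * K / ε))
  refine ⟨max (max D₁ D₂) Dl, fun D _ χ hD hq hp hA p hpW => ?_⟩
  have hD1 : D₁ ≤ D := le_trans (le_trans (le_max_left _ _) (le_max_left _ _)) hD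
  have hD2 : D₂ ≤ D := le_trans (le_trans (le_max_right _ _) (le_max_left _ _)) hD
  have hDl' : Dl ≤ D := le_trans (le_max_right _ _) hD
  obtain ⟨⟨⟨e12, e16⟩, e44⟩, esm⟩ := h₁ D χ hD1 hq hp
  have hM := h₂ D hD2
  have hℓ1 : 1 ≤ ell D := le_trans (le_max_left _ _) hM
  have hℓK : 32 * Real.exp 1 * K / ε ≤ ell D := le_trans (le_max_right _ _) hM
  have hℓ0 : 0 < ell D := by linarith
  have hLge := hDl D χ hDl' hq hp hA
  -- `L′(1,χ) ≠ 0`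
  have hρpos : 0 < (D : ℝ) / Nat.totient D := by
    have := NeZero.pos D
    have hφ := Nat.totient_pos.mpr this
    positivity
  have hL0 : deriv χ.LFunction 1 ≠ 0 := by
    intro h
    rw [h, norm_zero, mul_zero] at hLge
    linarith
  have h1mem : (1 : ℕ) ∈ ({1, 2} : Finset ℕ) := by simp
  have h2mem : (2 : ℕ) ∈ ({1, 2} : Finset ℕ) := by simp
  -- the inputs at this `D, χ, p`
  have g12 := e12 hA p hpW
  rw [Finset.sum_pair (by norm_num : (1 : ℕ) ≠ 2)] at g12
  have hx4 : 0 ≤ (ell D ^ 4)⁻¹ := by positivity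
  have g16₁ : ‖S D χ 1 - (frakA χ : ℂ) * frake 1 * ((Nat.totient D : ℂ) / (D : ℂ)) *
      deriv χ.LFunction 1‖ ≤ C₁' * (ell D ^ 4)⁻¹ :=
    (e16 hA 1 h1mem).trans (mul_le_mul_of_nonneg_right (le_max_left _ _) hx4)
  have g16₂ : ‖S D χ 2 - (frakA χ : ℂ) * frake 2 * ((Nat.totient D : ℂ) / (D : ℂ)) *
      deriv χ.LFunction 1‖ ≤ C₁' * (ell D ^ 4)⁻¹ :=
    (e16 hA 2 h2mem).trans (mul_le_mul_of_nonneg_right (le_max_left _ _) hx4)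
  have hy : 0 ≤ (ell D)⁻¹ * ‖deriv χ.LFunction 1‖⁻¹ := by positivity
  have g44₁ : ‖Rs D χ * R D χ 1 + 1 / deriv χ.LFunction 1‖ ≤
      C₂' * (ell D)⁻¹ * ‖deriv χ.LFunction 1‖⁻¹ := by
    refine (e44 hA 1 h1mem).trans ?_
    rw [mul_assoc, mul_assoc]
    exact mul_le_mul_of_nonneg_right (le_max_left _ _) hy
  have g44₂ : ‖Rs D χ * R D χ 2 + 1 / deriv χ.LFunction 1‖ ≤
      C₂' * (ell D)⁻¹ * ‖deriv χ.LFunction 1‖⁻¹ := by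
    refine (e44 hA 2 h2mem).trans ?_
    rw [mul_assoc, mul_assoc]
    exact mul_le_mul_of_nonneg_right (le_max_left _ _) hy
  have key := endgame_core (Φ := Φ D χ p) (Rs := Rs D χ) (e₁ := frake 1) (e₂ := frake 2) hL0
    (Nat.totient_pos.mpr (NeZero.pos D)) (NeZero.pos D) (frakA_nonneg χ) hC₁'0 hC₂'0 hℓ1 hLge
    (esm hA) g12 g16₁ g16₂ g44₁ g44₂
  refine key.trans (mul_le_mul_of_nonneg_right ?_ (Nat.cast_nonneg p))
  -- `ε/4 + 8eK𝓛⁻¹ + C₂'Eη ≤ ε`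
  have hmid : 8 * Real.exp 1 * (C₁' * C₂' + C₁') * (ell D)⁻¹ ≤ ε / 4 := by
    rw [← hK, ← div_eq_mul_inv, div_le_iff₀ hℓ0]
    have : 32 * Real.exp 1 * K ≤ ell D * ε := by rwa [div_le_iff₀ hε] at hℓK
    linarith
  have hlast : C₂' * (‖frake 1‖ + ‖frake 2‖) * η ≤ ε / 4 := by rw [← hE]; exact hη4
  linarith

end Endgame

end Literature.NumberTheory.LFunctions.Zhang2022.Skeleton
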